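import Summits.CriticalPhenomena.PercolationContinuityZ3.Theorems.PercNearOneGluingNoHeavyLowerTailThreePointGammaEdgePolarPrelim
import HarnessLib

/-!
# `NoHeavyLowerTail` (stmt-CriticalPhenomena-4575) — comb positivity of `Γ`, I: signed three-copy states of a set of pairs, toggles, cancellation

Support file (prover prim-ineq-gen-2 gen 5; `--supports stmt-CriticalPhenomena-4575`).  Technical definitions, no named facts, no sorries.
Setting of prim-ineq-gen-2's GAMMA-COMB-THEOREM.md §3: a base configuration `X` (copy `0`) and a set `M` of pairs; a STATE `κ = (S₁,S₂,S₃)` puts pairwise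
disjoint subsets of `M` into copies `0,1,2`, the rest carries the sign `sgn κ = (−1)^{#(M ∖ (S₁∪S₂∪S₃))}`.  The clusters seen by a pair `e` are
`cA κ e = cl (X ∪ S₁.erase e) a`, `cB κ e = cl (X ∪ S₁.erase e) b` (computed WITHOUT `e`, so toggling `e` does not move them).  Given "unread" predicates
`uY uZ` of the two clusters, `tog e` toggles `e` between copy `0` and "not inserted" when `e` meets neither cluster, else between "not inserted" and copy
`1` if `uY`, else copy `2` if `uZ`; `fixedP e` says no toggle applies.  `sum_sgn_eq_sum_fixed`: a toggle-invariant weight has the same signed sum over all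
states as over the states fixed for every pair (induction on the fixed pairs + `Finset.sum_involution`); `sgn_eq_one_of_fixed`: there the sign is `+1`.
-/

noncomputable section

namespace Summit.CriticalPhenomena.PercolationContinuityZ3.Theorems

namespace ThreePointGamma

open Finset Literature.Probability.Percolation Literature.Probability.Percolation.DecisionTree
open Literature.Probability.Percolation.Gladkov ThreePointLB
open scoped Classical

variable {V : Type*} [Fintype V] [DecidableEq V]
/-! ### States -/

/-- A state of a set of pairs: the pairs put into copies `0, 1, 2`. [this work] -/
abbrev St (V : Type*) := Finset (Sym2 V) × Finset (Sym2 V) × Finset (Sym2 V)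

/-- The admissible states of `M`: triples of pairwise disjoint subsets of `M`. [this work] -/
def Asg (M : Finset (Sym2 V)) : Finset (St V) :=
  (M.powerset ×ˢ (M.powerset ×ˢ M.powerset)).filter
    (fun κ => Disjoint κ.1 κ.2.1 ∧ Disjoint κ.1 κ.2.2 ∧ Disjoint κ.2.1 κ.2.2)

omit [Fintype V] in
/-- Membership in `Asg`. [this work] -/
theorem mem_Asg {M : Finset (Sym2 V)} {κ : St V} :
    κ ∈ Asg M ↔ κ.1 ⊆ M ∧ κ.2.1 ⊆ M ∧ κ.2.2 ⊆ M ∧ Disjoint κ.1 κ.2.1 ∧ Disjoint κ.1 κ.2.2 ∧ Disjoint κ.2.1 κ.2.2 := by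
  simp only [Asg, mem_filter, mem_product, mem_powerset]
  tauto

/-- The sign of a state: `(−1)^{number of pairs of M not inserted}`. [this work] -/
def sgn (M : Finset (Sym2 V)) (κ : St V) : ℝ := (-1) ^ (M \ (κ.1 ∪ κ.2.1 ∪ κ.2.2)).card

omit [Fintype V] in
/-- Toggle membership of one element. [folklore] -/
def flip1 (e : Sym2 V) (S : Finset (Sym2 V)) : Finset (Sym2 V) := if e ∈ S then S.erase e else insert e S

omit [Fintype V] in
/-- Membership in `flip1`. [folklore] -/
theorem mem_flip1 {e f : Sym2 V} {S : Finset (Sym2 V)} : f ∈ flip1 e S ↔ (f = e ∧ e ∉ S) ∨ (f ≠ e ∧ f ∈ S) := by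
  unfold flip1
  split_ifs with h
  · rw [mem_erase]; constructor
    · rintro ⟨hne, hf⟩; exact Or.inr ⟨hne, hf⟩
    · rintro (⟨rfl, hn⟩ | ⟨hne, hf⟩); · exact absurd h hn
      exact ⟨hne, hf⟩
  · rw [mem_insert]; constructor
    · rintro (rfl | hf); · exact Or.inl ⟨rfl, h⟩
      exact if hfe : f = e then Or.inl ⟨hfe, h⟩ else Or.inr ⟨hfe, hf⟩
    · rintro (⟨rfl, -⟩ | ⟨-, hf⟩); · exact Or.inl rfl
      exact Or.inr hf

omit [Fintype V] in
/-- `flip1` is an involution. [folklore] -/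
theorem flip1_flip1 (e : Sym2 V) (S : Finset (Sym2 V)) : flip1 e (flip1 e S) = S := by
  ext f
  simp only [mem_flip1]
  by_cases hfe : f = e
  · subst hfe; simp
  · simp [hfe]

omit [Fintype V] in
/-- `flip1 e S ≠ S`. [folklore] -/
theorem flip1_ne (e : Sym2 V) (S : Finset (Sym2 V)) : flip1 e S ≠ S := by
  intro h
  have := (mem_flip1 (e := e) (f := e) (S := S))
  rw [h] at this
  by_cases he : e ∈ S
  · exact absurd (this.1 he) (by simp [he])
  · exact he (this.2 (Or.inl ⟨rfl, he⟩))

omit [Fintype V] in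
/-- Off `e`, `flip1 e` changes nothing. [folklore] -/
theorem mem_flip1_of_ne {e f : Sym2 V} {S : Finset (Sym2 V)} (h : f ≠ e) : f ∈ flip1 e S ↔ f ∈ S := by
  rw [mem_flip1]; simp [h]

omit [Fintype V] in
/-- `erase e (flip1 e S) = erase e S`. [folklore] -/
theorem erase_flip1 (e : Sym2 V) (S : Finset (Sym2 V)) : (flip1 e S).erase e = S.erase e := by
  ext f
  simp only [mem_erase, mem_flip1]
  by_cases hfe : f = e
  · simp [hfe]
  · simp [hfe]

omit [Fintype V] in
/-- `flip1` stays inside `M` for `e ∈ M`. [folklore] -/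
theorem flip1_subset {e : Sym2 V} {S M : Finset (Sym2 V)} (he : e ∈ M) (hS : S ⊆ M) : flip1 e S ⊆ M := by
  intro f hf
  rcases mem_flip1.1 hf with ⟨rfl, -⟩ | ⟨-, hf⟩
  · exact he
  · exact hS hf

omit [Fintype V] in
/-- Disjointness is preserved by flipping a pair absent from the other set. [folklore] -/
theorem disjoint_flip1 {e : Sym2 V} {S T : Finset (Sym2 V)} (hST : Disjoint S T) (he : e ∉ T) : Disjoint (flip1 e S) T := by
  rw [Finset.disjoint_left] at hST ⊢
  intro f hf
  rcases mem_flip1.1 hf with ⟨rfl, -⟩ | ⟨-, hf⟩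
  · exact he
  · exact hST hf

omit [Fintype V] in
/-- The sign flips under a one-pair toggle of the inserted set. [folklore] -/
theorem neg_one_pow_sdiff_flip {M U : Finset (Sym2 V)} {e : Sym2 V} (he : e ∈ M) :
    ((-1 : ℝ)) ^ (M \ flip1 e U).card = - (-1) ^ (M \ U).card := by
  by_cases heU : e ∈ U
  · -- `e` leaves `U`: `M \ flip = insert e (M \ U)`
    have h : M \ flip1 e U = insert e (M \ U) := by
      ext f; simp only [mem_sdiff, mem_insert, mem_flip1]
      by_cases hfe : f = e
      · subst hfe; simp [he, heU]
      · simp [hfe]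
    rw [h, card_insert_of_notMem (by simp [heU]), pow_succ]; ring
  · -- `e` enters `U`: `M \ U = insert e (M \ flip)`
    have h : M \ U = insert e (M \ flip1 e U) := by
      ext f; simp only [mem_sdiff, mem_insert, mem_flip1]
      by_cases hfe : f = e
      · subst hfe; simp [he, heU]
      · simp [hfe]
    rw [h, card_insert_of_notMem (by simp [mem_flip1, heU]), pow_succ]; ring

/-! ### The clusters seen by a pair, and the toggles -/

section Tog

variable (uY uZ : Finset V → Finset V → Sym2 V → Prop) (X : Finset (Sym2 V)) (a b : V)

/-- The cluster of `a` in copy `0` of the state, computed without the pair `e`. [this work] -/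
def cA (κ : St V) (e : Sym2 V) : Finset V := cl (X ∪ κ.1.erase e) a
/-- The cluster of `b` in copy `0` of the state, computed without the pair `e`. [this work] -/
def cB (κ : St V) (e : Sym2 V) : Finset V := cl (X ∪ κ.1.erase e) b

/-- `e` meets neither cluster. [this work] -/
def nb (κ : St V) (e : Sym2 V) : Prop := e ∉ touch (cA X a κ e) ∧ e ∉ touch (cB X b κ e)

/-- The state is fixed for the pair `e`: `e` sits in a position where no toggle applies. [this work] -/
def fixedP (κ : St V) (e : Sym2 V) : Prop :=
  (nb X a b κ e → (e ∈ κ.2.1 ∨ e ∈ κ.2.2)) ∧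
  (¬ nb X a b κ e → uY (cA X a κ e) (cB X b κ e) e → (e ∈ κ.1 ∨ e ∈ κ.2.2)) ∧
  (¬ nb X a b κ e → ¬ uY (cA X a κ e) (cB X b κ e) e → uZ (cA X a κ e) (cB X b κ e) e → (e ∈ κ.1 ∨ e ∈ κ.2.1))

/-- The toggle of the pair `e`. [this work] -/
def tog (κ : St V) (e : Sym2 V) : St V :=
  if nb X a b κ e then (if e ∈ κ.2.1 ∨ e ∈ κ.2.2 then κ else (flip1 e κ.1, κ.2.1, κ.2.2))
  else if uY (cA X a κ e) (cB X b κ e) e then (if e ∈ κ.1 ∨ e ∈ κ.2.2 then κ else (κ.1, flip1 e κ.2.1, κ.2.2))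
  else if uZ (cA X a κ e) (cB X b κ e) e then (if e ∈ κ.1 ∨ e ∈ κ.2.1 then κ else (κ.1, κ.2.1, flip1 e κ.2.2))
  else κ

variable {uY uZ X a b}

/-- The three shapes a non-trivial toggle can take. [this work] -/
theorem tog_cases (κ : St V) (e : Sym2 V) (h : ¬ fixedP uY uZ X a b κ e) :
    (nb X a b κ e ∧ e ∉ κ.2.1 ∧ e ∉ κ.2.2 ∧ tog uY uZ X a b κ e = (flip1 e κ.1, κ.2.1, κ.2.2)) ∨
    (¬ nb X a b κ e ∧ uY (cA X a κ e) (cB X b κ e) e ∧ e ∉ κ.1 ∧ e ∉ κ.2.2 ∧ tog uY uZ X a b κ e = (κ.1, flip1 e κ.2.1, κ.2.2)) ∨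
    (¬ nb X a b κ e ∧ ¬ uY (cA X a κ e) (cB X b κ e) e ∧ uZ (cA X a κ e) (cB X b κ e) e ∧ e ∉ κ.1 ∧ e ∉ κ.2.1 ∧
      tog uY uZ X a b κ e = (κ.1, κ.2.1, flip1 e κ.2.2)) := by
  unfold fixedP at h
  unfold tog
  by_cases h1 : nb X a b κ e
  · have h' : ¬ (e ∈ κ.2.1 ∨ e ∈ κ.2.2) := fun hh => h ⟨fun _ => hh, fun hn => absurd h1 hn, fun hn => absurd h1 hn⟩
    refine Or.inl ⟨h1, fun hh => h' (Or.inl hh), fun hh => h' (Or.inr hh), ?_⟩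
    rw [if_pos h1, if_neg h']
  · by_cases h2 : uY (cA X a κ e) (cB X b κ e) e
    · have h' : ¬ (e ∈ κ.1 ∨ e ∈ κ.2.2) := fun hh => h ⟨fun hn => absurd hn h1, fun _ _ => hh, fun _ hn => absurd h2 hn⟩
      refine Or.inr (Or.inl ⟨h1, h2, fun hh => h' (Or.inl hh), fun hh => h' (Or.inr hh), ?_⟩)
      rw [if_neg h1, if_pos h2, if_neg h']
    · by_cases h3 : uZ (cA X a κ e) (cB X b κ e) e
      · have h' : ¬ (e ∈ κ.1 ∨ e ∈ κ.2.1) := fun hh => h ⟨fun hn => absurd hn h1, fun _ hy => absurd hy h2, fun _ _ _ => hh⟩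
        refine Or.inr (Or.inr ⟨h1, h2, h3, fun hh => h' (Or.inl hh), fun hh => h' (Or.inr hh), ?_⟩)
        rw [if_neg h1, if_neg h2, if_pos h3, if_neg h']
      · exact absurd ⟨fun hn => absurd hn h1, fun _ hy => absurd hy h2, fun _ _ hz => absurd hz h3⟩ h

/-- **Cluster invariance**: toggling `e` does not change the clusters seen by ANY pair `f` (the toggle moves `e` in or out of copy `0` only when `e`
meets neither cluster of `X ∪ S₁.erase e`). Requires `e ∉ X`. [this work] -/
theorem cl_erase_tog (κ : St V) (e : Sym2 V) (heX : e ∉ X) (h : ¬ fixedP uY uZ X a b κ e) (f : Sym2 V) (x : V) (hx : x = a ∨ x = b) :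
    cl (X ∪ (tog uY uZ X a b κ e).1.erase f) x = cl (X ∪ κ.1.erase f) x := by
  rcases tog_cases κ e h with ⟨hnb, -, -, ht⟩ | ⟨-, -, -, -, ht⟩ | ⟨-, -, -, -, -, ht⟩
  · rw [ht]
    by_cases hfe : f = e
    · subst hfe; simp only [erase_flip1]
    · -- both sides are the cluster of `x` in `K₀ = X ∪ (κ.1 ∖ {e,f})` with or without `e`, and `e` meets neither cluster of `K₀`
      have hsub : X ∪ (κ.1.erase f).erase e ⊆ X ∪ κ.1.erase e := by
        intro g hg; rcases mem_union.1 hg with hg | hg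
        · exact mem_union_left _ hg
        · exact mem_union_right _ (mem_erase.2 ⟨(mem_erase.1 hg).1, (mem_erase.1 (mem_erase.1 hg).2).2⟩)
      have hnot : e ∉ touch (cl (X ∪ (κ.1.erase f).erase e) x) := by
        rcases hx with rfl | rfl
        · exact fun hh => hnb.1 (touch_mono (cl_mono hsub _) hh)
        · exact fun hh => hnb.2 (touch_mono (cl_mono hsub _) hh)
      have hins : cl (insert e (X ∪ (κ.1.erase f).erase e)) x = cl (X ∪ (κ.1.erase f).erase e) x := cl_insert_of_not_mem_touch hnot
      -- identify the two configurations
      have hK : ∀ S : Finset (Sym2 V), X ∪ S.erase f = (if e ∈ S then insert e (X ∪ (S.erase f).erase e) else X ∪ (S.erase f).erase e) := by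
        intro S; split_ifs with heS
        · ext g; simp only [mem_union, mem_erase, mem_insert]
          by_cases hge : g = e
          · subst hge; simp [heS, Ne.symm hfe]
          · simp [hge]
        · ext g; simp only [mem_union, mem_erase]
          by_cases hge : g = e
          · subst hge; simp [heS, heX]
          · simp [hge]
      have h1 := hK (flip1 e κ.1)
      have h2 := hK κ.1
      have hee : (flip1 e κ.1).erase f = flip1 e (κ.1.erase f) := by
        ext g; simp only [mem_erase, mem_flip1]; by_cases hge : g = e
        · subst hge; simp [Ne.symm hfe]
        · simp [hge]
      have hee' : ((flip1 e κ.1).erase f).erase e = (κ.1.erase f).erase e := by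
        rw [hee, erase_flip1]
      rw [hee'] at h1
      by_cases heS : e ∈ κ.1
      · have : e ∉ flip1 e κ.1 := by simp [mem_flip1, heS]
        rw [if_neg this] at h1; rw [if_pos heS] at h2
        rw [h1, h2, hins]
      · have : e ∈ flip1 e κ.1 := by simp [mem_flip1, heS]
        rw [if_pos this] at h1; rw [if_neg heS] at h2
        rw [h1, h2, hins]
  · rw [ht]
  · rw [ht]

/-- `cA` is toggle-invariant. [this work] -/
theorem cA_tog (κ : St V) (e : Sym2 V) (heX : e ∉ X) (h : ¬ fixedP uY uZ X a b κ e) (f : Sym2 V) :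
    cA X a (tog uY uZ X a b κ e) f = cA X a κ f := cl_erase_tog κ e heX h f a (Or.inl rfl)

/-- `cB` is toggle-invariant. [this work] -/
theorem cB_tog (κ : St V) (e : Sym2 V) (heX : e ∉ X) (h : ¬ fixedP uY uZ X a b κ e) (f : Sym2 V) :
    cB X b (tog uY uZ X a b κ e) f = cB X b κ f := cl_erase_tog κ e heX h f b (Or.inr rfl)

/-- Membership of another pair `f ≠ e` in the three components is toggle-invariant. [this work] -/
theorem mem_tog_of_ne (κ : St V) (e : Sym2 V) (h : ¬ fixedP uY uZ X a b κ e) {f : Sym2 V} (hfe : f ≠ e) :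
    (f ∈ (tog uY uZ X a b κ e).1 ↔ f ∈ κ.1) ∧ (f ∈ (tog uY uZ X a b κ e).2.1 ↔ f ∈ κ.2.1) ∧ (f ∈ (tog uY uZ X a b κ e).2.2 ↔ f ∈ κ.2.2) := by
  rcases tog_cases κ e h with ⟨-, -, -, ht⟩ | ⟨-, -, -, -, ht⟩ | ⟨-, -, -, -, -, ht⟩ <;> rw [ht] <;> simp [mem_flip1_of_ne hfe]

/-- Fixedness of another pair is toggle-invariant. [this work] -/
theorem fixedP_tog_of_ne (κ : St V) (e : Sym2 V) (heX : e ∉ X) (h : ¬ fixedP uY uZ X a b κ e) {f : Sym2 V} (hfe : f ≠ e) :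
    fixedP uY uZ X a b (tog uY uZ X a b κ e) f ↔ fixedP uY uZ X a b κ f := by
  have hm := mem_tog_of_ne κ e h hfe
  unfold fixedP nb
  rw [cA_tog κ e heX h f, cB_tog κ e heX h f, hm.1, hm.2.1, hm.2.2]

/-- The toggled state is again not fixed at `e` (so the toggle is an involution on non-fixed states). [this work] -/
theorem not_fixedP_tog (κ : St V) (e : Sym2 V) (heX : e ∉ X) (h : ¬ fixedP uY uZ X a b κ e) :
    ¬ fixedP uY uZ X a b (tog uY uZ X a b κ e) e := by
  have hA := cA_tog κ e heX h e
  have hB := cB_tog κ e heX h e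
  intro hf
  unfold fixedP nb at hf
  rw [hA, hB] at hf
  rcases tog_cases κ e h with ⟨hnb, h2, h3, ht⟩ | ⟨hnb, huy, h1, h3, ht⟩ | ⟨hnb, huy, huz, h1, h2, ht⟩
  · rw [ht] at hf; exact (hf.1 hnb).elim h2 h3
  · rw [ht] at hf
    rcases hf.2.1 hnb huy with hh | hh
    · exact h1 hh
    · exact h3 hh
  · rw [ht] at hf
    rcases hf.2.2 hnb huy huz with hh | hh
    · exact h1 hh
    · exact h2 hh

/-- The toggle is an involution on non-fixed states. [this work] -/
theorem tog_tog (κ : St V) (e : Sym2 V) (heX : e ∉ X) (h : ¬ fixedP uY uZ X a b κ e) :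
    tog uY uZ X a b (tog uY uZ X a b κ e) e = κ := by
  have hA := cA_tog κ e heX h e
  have hB := cB_tog κ e heX h e
  have hnb' : nb X a b (tog uY uZ X a b κ e) e ↔ nb X a b κ e := by unfold nb; rw [hA, hB]
  have hdef : ∀ μ : St V, tog uY uZ X a b μ e =
      (if nb X a b μ e then (if e ∈ μ.2.1 ∨ e ∈ μ.2.2 then μ else (flip1 e μ.1, μ.2.1, μ.2.2))
      else if uY (cA X a μ e) (cB X b μ e) e then (if e ∈ μ.1 ∨ e ∈ μ.2.2 then μ else (μ.1, flip1 e μ.2.1, μ.2.2))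
      else if uZ (cA X a μ e) (cB X b μ e) e then (if e ∈ μ.1 ∨ e ∈ μ.2.1 then μ else (μ.1, μ.2.1, flip1 e μ.2.2))
      else μ) := fun μ => rfl
  rw [hdef (tog uY uZ X a b κ e)]
  rcases tog_cases κ e h with ⟨hnb, h2, h3, ht⟩ | ⟨hnb, huy, h1, h3, ht⟩ | ⟨hnb, huy, huz, h1, h2, ht⟩
  · have hn2 : nb X a b (tog uY uZ X a b κ e) e := hnb'.2 hnb
    rw [if_pos hn2, ht]
    simp [h2, h3, flip1_flip1]
  · have hn2 : ¬ nb X a b (tog uY uZ X a b κ e) e := fun hh => hnb (hnb'.1 hh)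
    rw [if_neg hn2, hA, hB, if_pos huy, ht]
    simp [h1, h3, flip1_flip1]
  · have hn2 : ¬ nb X a b (tog uY uZ X a b κ e) e := fun hh => hnb (hnb'.1 hh)
    rw [if_neg hn2, hA, hB, if_neg huy, if_pos huz, ht]
    simp [h1, h2, flip1_flip1]

/-- A non-trivial toggle moves the state. [this work] -/
theorem tog_ne (κ : St V) (e : Sym2 V) (h : ¬ fixedP uY uZ X a b κ e) : tog uY uZ X a b κ e ≠ κ := by
  rcases tog_cases κ e h with ⟨-, -, -, ht⟩ | ⟨-, -, -, -, ht⟩ | ⟨-, -, -, -, -, ht⟩ <;> rw [ht] <;> intro hh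
  · exact flip1_ne e κ.1 (congrArg Prod.fst hh)
  · exact flip1_ne e κ.2.1 (congrArg (fun q => q.2.1) hh)
  · exact flip1_ne e κ.2.2 (congrArg (fun q => q.2.2) hh)

/-- A toggle of `e ∈ M` stays admissible. [this work] -/
theorem tog_mem_Asg {M : Finset (Sym2 V)} (κ : St V) (hκ : κ ∈ Asg M) (e : Sym2 V) (he : e ∈ M) (h : ¬ fixedP uY uZ X a b κ e) :
    tog uY uZ X a b κ e ∈ Asg M := by
  obtain ⟨h1, h2, h3, d12, d13, d23⟩ := mem_Asg.1 hκ
  rcases tog_cases κ e h with ⟨-, he2, he3, ht⟩ | ⟨-, -, he1, he3, ht⟩ | ⟨-, -, -, he1, he2, ht⟩ <;> rw [ht] <;> refine mem_Asg.2 ?_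
  · exact ⟨flip1_subset he h1, h2, h3, disjoint_flip1 d12 he2, disjoint_flip1 d13 he3, d23⟩
  · exact ⟨h1, flip1_subset he h2, h3, (disjoint_flip1 d12.symm he1).symm, d13, disjoint_flip1 d23 he3⟩
  · exact ⟨h1, h2, flip1_subset he h3, d12, (disjoint_flip1 d13.symm he1).symm, (disjoint_flip1 d23.symm he2).symm⟩

/-- A toggle of `e ∈ M` reverses the sign. [this work] -/
theorem sgn_tog {M : Finset (Sym2 V)} (κ : St V) (e : Sym2 V) (he : e ∈ M) (h : ¬ fixedP uY uZ X a b κ e) :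
    sgn M (tog uY uZ X a b κ e) = - sgn M κ := by
  unfold sgn
  rcases tog_cases κ e h with ⟨-, he2, he3, ht⟩ | ⟨-, -, he1, he3, ht⟩ | ⟨-, -, -, he1, he2, ht⟩ <;> rw [ht] <;> simp only
  · have : flip1 e κ.1 ∪ κ.2.1 ∪ κ.2.2 = flip1 e (κ.1 ∪ κ.2.1 ∪ κ.2.2) := by
      ext f; simp only [mem_union, mem_flip1]; by_cases hfe : f = e
      · subst hfe; simp [he2, he3]
      · simp [hfe]
    rw [this, neg_one_pow_sdiff_flip he]
  · have : κ.1 ∪ flip1 e κ.2.1 ∪ κ.2.2 = flip1 e (κ.1 ∪ κ.2.1 ∪ κ.2.2) := by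
      ext f; simp only [mem_union, mem_flip1]; by_cases hfe : f = e
      · subst hfe; simp [he1, he3]
      · simp [hfe]
    rw [this, neg_one_pow_sdiff_flip he]
  · have : κ.1 ∪ κ.2.1 ∪ flip1 e κ.2.2 = flip1 e (κ.1 ∪ κ.2.1 ∪ κ.2.2) := by
      ext f; simp only [mem_union, mem_flip1]; by_cases hfe : f = e
      · subst hfe; simp [he1, he2]
      · simp [hfe]
    rw [this, neg_one_pow_sdiff_flip he]

/-! ### The cancellation lemma -/

/-- **Cancellation**: if a weight `v` is invariant under every non-trivial toggle of pairs of `M` (disjoint from `X`), the signed sum of `v` over all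
states equals the signed sum over the states fixed for every pair of `M`. [this work] -/
theorem sum_sgn_eq_sum_fixed {M : Finset (Sym2 V)} (hXM : ∀ e ∈ M, e ∉ X) (v : St V → ℝ)
    (hv : ∀ κ ∈ Asg M, ∀ e ∈ M, ¬ fixedP uY uZ X a b κ e → v (tog uY uZ X a b κ e) = v κ) :
    ∑ κ ∈ Asg M, sgn M κ * v κ = ∑ κ ∈ (Asg M).filter (fun κ => ∀ e ∈ M, fixedP uY uZ X a b κ e), sgn M κ * v κ := by
  -- induction on the set `N ⊆ M` of pairs already fixed
  suffices h : ∀ N : Finset (Sym2 V), N ⊆ M →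
      ∑ κ ∈ Asg M, sgn M κ * v κ = ∑ κ ∈ (Asg M).filter (fun κ => ∀ e ∈ N, fixedP uY uZ X a b κ e), sgn M κ * v κ from h M subset_rfl
  intro N
  induction N using Finset.induction_on with
  | empty => intro; simp
  | @insert e N heN ih =>
    intro hNM
    have he : e ∈ M := hNM (mem_insert_self e N)
    rw [ih ((subset_insert e N).trans hNM)]
    -- split the `N`-fixed states by fixedness at `e`
    have hsplit := (sum_filter_add_sum_filter_not ((Asg M).filter (fun κ => ∀ f ∈ N, fixedP uY uZ X a b κ f))
      (fun κ => fixedP uY uZ X a b κ e) (fun κ => sgn M κ * v κ)).symm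
    rw [hsplit, filter_filter, filter_filter]
    have hzero : ∑ κ ∈ (Asg M).filter (fun κ => (∀ f ∈ N, fixedP uY uZ X a b κ f) ∧ ¬ fixedP uY uZ X a b κ e), sgn M κ * v κ = 0 := by
      refine sum_involution (fun κ _ => tog uY uZ X a b κ e) ?_ ?_ ?_ ?_
      · intro κ hκ
        obtain ⟨hA, -, hne⟩ := mem_filter.1 hκ
        rw [sgn_tog κ e he hne, hv κ hA e he hne]; ring
      · intro κ hκ _
        exact tog_ne κ e (mem_filter.1 hκ).2.2
      · intro κ hκ
        obtain ⟨hA, hN, hne⟩ := mem_filter.1 hκ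
        refine mem_filter.2 ⟨tog_mem_Asg κ hA e he hne, fun f hf => ?_, not_fixedP_tog κ e (hXM e he) hne⟩
        have hfe : f ≠ e := fun h => heN (h ▸ hf)
        exact (fixedP_tog_of_ne κ e (hXM e he) hne hfe).2 (hN f hf)
      · intro κ hκ
        exact tog_tog κ e (hXM e he) (mem_filter.1 hκ).2.2
    rw [hzero, add_zero]
    refine sum_congr ?_ fun _ _ => rfl
    ext κ
    simp only [mem_filter, mem_insert, forall_eq_or_imp]
    tauto

/-- On a state fixed for every pair of `M`, every pair is inserted somewhere (when the predicates cover), so the sign is `+1`. [this work] -/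
theorem sgn_eq_one_of_fixed {M : Finset (Sym2 V)} (hcov : ∀ A B : Finset V, ∀ e : Sym2 V, (e ∉ touch A ∧ e ∉ touch B) ∨ uY A B e ∨ uZ A B e)
    (κ : St V) (hfix : ∀ e ∈ M, fixedP uY uZ X a b κ e) : sgn M κ = 1 := by
  unfold sgn
  have h : M \ (κ.1 ∪ κ.2.1 ∪ κ.2.2) = ∅ := by
    refine eq_empty_of_forall_notMem fun e he => ?_
    obtain ⟨heM, hnot⟩ := mem_sdiff.1 he
    simp only [mem_union, not_or] at hnot
    obtain ⟨h1, h2, h3⟩ := hfix e heM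
    have hc := hcov (cA X a κ e) (cB X b κ e) e
    by_cases hn : nb X a b κ e
    · exact (h1 hn).elim hnot.1.2 hnot.2
    by_cases hy : uY (cA X a κ e) (cB X b κ e) e
    · exact (h2 hn hy).elim hnot.1.1 hnot.2
    have hz : uZ (cA X a κ e) (cB X b κ e) e := (hc.resolve_left hn).resolve_left hy
    exact (h3 hn hy hz).elim hnot.1.1 hnot.1.2
  rw [h, card_empty, pow_zero]

end Tog

end ThreePointGamma

end Summit.CriticalPhenomena.PercolationContinuityZ3.Theorems

end
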